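import Mathlib.Algebra.Order.Field.Basic
import Mathlib.Algebra.Order.BigOperators.Group.Finset
import Mathlib.Algebra.BigOperators.Group.Finset.Basic
import Mathlib.Tactic.Ring
import Mathlib.Tactic.Linarith
import Mathlib.Tactic.LinearCombination
import Summits.Ventures.CertifiedArithmetic.LowPrec.SRAccumulation
import HarnessLib

/-!
# Stochastic rounding into a finite format, XXIX: compensated (Kahan) summation — exact mean
# and exact variance

HONEST FRAMING: certified error envelopes and provably optimal rounding/accumulation schemes for
low-precision formats under stated cost models; every table by two implementations; no hardware or
vendor claims.

Kahan's compensated summation EXECUTED under saturating mode-2 stochastic rounding into a finite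
format `F`, every one of the `4n` operations a fresh SR (definitions of `SRStep`) whose law depends
on the exact pre-rounding value: `y = SR(xₖ − c)`, `t = SR(s + y)`, `d = SR(t − s)`,
`c ← SR(d − y)`, `s ← t`; output the pair `(sₙ, cₙ)` and the corrected value `sₙ − cₙ`. No measure
theory: the law is a finite `16ⁿ`-leaf outcome tree and we use the backward recursion
`kahanExp F x n g s c = E[g(sₙ, cₙ)]` (exact in `K`, computable, kernel-`decide`d on formats).

THE ALGEBRA. With `ε` the local errors (rounded minus exact value) of one step,
`c' = εᵗ + εᵈ + εᶜ` and `t − c' = (s − c) + x + εʸ − εᵈ − εᶜ`: the error `εᵗ` of the LARGE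
addition — saturation defect included — cancels identically on every branch. Mean independence
of the other three errors (CHM21 Lemma 4.5, here `step_centered`) gives, for every finite format:
* `kahanExp_sub_of_noSatK` — **exact unbiasedness of the corrected sum**
  `E[sₙ − cₙ] = s − c + ∑ xₖ` whenever no SMALL operation (y-, d-, c-op) saturates on any branch
  (`NoSatK`); NOTHING is asked of the `n` large additions, which may saturate freely;
* `kahanExp_sq_sub` — **EXACT VARIANCE IDENTITY**
  `E[(sₙ − cₙ − a)²] = kahanVar + (s − c + ∑ xₖ − a)²`, `kahanVar = ∑` over the `3n` small
  operations of the expected conditional variances `E[v_F]`; the large additions — the only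
  operations at partial-sum magnitude and the whole variance `accVar` of plain recursive SR
  summation (`SRAccumulation`) — carry weight ZERO.
Also: path predicates `SmallOps Py Pd Pc` (every pre-rounding value of a y-, d- or c-op on every
branch satisfies `Py`, `Pd`, `Pc`), linearity and monotonicity of `kahanExp`, the one-step
identities `kahanStep_sub`, `kahanStep_sq`. Decidability, envelopes, Chebyshev: file
`SRKahanEnvelopes`; format corollaries and kernel certificates: file `SRKahanFormats`.

References / positioning: compensated summation [Higham2002, §4.3]; [ConnollyHighamMary2021] §3
(under SR it satisfies the directed-rounding bounds of [GraillatJezequelPicot2015]), Lemma 4.5,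
Thm 4.13; [CastroEtAl2024] (martingale / Azuma–Hoeffding bounds for multilinear straight-line
programs under SR, relative-error model, no saturation). The finite-format EXACT identities with
saturation, the weight-zero structure and the certificates are this venture's additions.
-/

namespace Summit.Ventures.CertifiedArithmetic.LowPrec.SR

open Literature.ComputerArithmetic.ConnollyHighamMary2021
open Finset

variable {K : Type*} [Field K] [LinearOrder K] [IsStrictOrderedRing K]

/-! ### One compensated step and the backward recursion -/

/-- The two inner operations of a Kahan step as a nested expectation: given the old sum `s`, the
rounded increment `y` and the new sum `t`: `d = SR(t − s)`, `c' = SR(d − y)`, then `g t c'`. -/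
def kahanInner (F : Finset K) (s y t : K) (g : K → K → K) : K :=
  step F (t - s) fun d => step F (d - y) fun c' => g t c'

/-- One Kahan step from the state `(s, c)` with summand `x`, as a nested (16-term) expectation
of `g` at the new state: `y = SR(x − c)`, `t = SR(s + y)`, then `kahanInner`. -/
def kahanStep (F : Finset K) (x s c : K) (g : K → K → K) : K :=
  step F (x - c) fun y => step F (s + y) fun t => kahanInner F s y t g

/-- `kahanExp F x n g s c = E[g(sₙ, cₙ)]`: compensated summation of `x 0, …, x (n − 1)` started at
the state `(s, c)`, every operation a fresh saturating mode-2 SR into `F`. -/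
def kahanExp (F : Finset K) : (ℕ → K) → ℕ → (K → K → K) → K → K → K
  | _, 0, g, s, c => g s c
  | x, n + 1, g, s, c => kahanStep F (x 0) s c (kahanExp F (fun i => x (i + 1)) n g)

/-- Expected conditional variances of the two inner operations (given `s, y, t`):
`v_F(clamp(t − s)) + E_d[v_F(clamp(d − y))]`. -/
def innerVar (F : Finset K) (s y t : K) : K :=
  srVar F (clamp F (t - s)) + step F (t - s) fun d => srVar F (clamp F (d - y))

/-- Expected sum of the conditional variances of the THREE SMALL operations of one step (y-, d- and
c-op). The large addition `t = SR(s + y)` contributes nothing. -/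
def localVar (F : Finset K) (x s c : K) : K :=
  srVar F (clamp F (x - c)) + step F (x - c) fun y => step F (s + y) fun t => innerVar F s y t

/-- Accumulated variance of compensated summation: `localVar` summed in expectation along the
process (`3n` small-operation terms). -/
def kahanVar (F : Finset K) : (ℕ → K) → ℕ → K → K → K
  | _, 0, _, _ => 0
  | x, n + 1, s, c =>
      localVar F (x 0) s c + kahanStep F (x 0) s c (kahanVar F (fun i => x (i + 1)) n)

/-! ### Path predicates (nothing is asked of the large additions) -/

/-- `P` holds at both candidates of the saturating SR of `e`. -/
def OnBoth (F : Finset K) (e : K) (P : K → Prop) : Prop := P (up F e) ∧ P (dn F e)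

/-- Every state `(t, c')` reachable in one Kahan step from `(s, c)` (summand `x`) satisfies
`P`. -/
def StepAll (F : Finset K) (x s c : K) (P : K → K → Prop) : Prop :=
  OnBoth F (x - c) fun y => OnBoth F (s + y) fun t => OnBoth F (t - s) fun d =>
    OnBoth F (d - y) fun c' => P t c'

/-- In ONE step, the pre-rounding value of the y-op (`x − c`) satisfies `Py`, of the d-op (`t − s`,
every candidate `y, t`) `Pd`, of the c-op (`d − y`, every candidate `y, t, d`) `Pc`. -/
def StepSmall (F : Finset K) (Py Pd Pc : K → Prop) (x s c : K) : Prop :=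
  Py (x - c) ∧ OnBoth F (x - c) fun y => OnBoth F (s + y) fun t =>
    Pd (t - s) ∧ OnBoth F (t - s) fun d => Pc (d - y)

/-- `SmallOps F Py Pd Pc x n s c`: on every branch of the outcome tree every pre-rounding value of a
y-op satisfies `Py`, of a d-op `Pd`, of a c-op `Pc`. -/
def SmallOps (F : Finset K) (Py Pd Pc : K → Prop) : (ℕ → K) → ℕ → K → K → Prop
  | _, 0, _, _ => True
  | x, n + 1, s, c => StepSmall F Py Pd Pc (x 0) s c
      ∧ StepAll F (x 0) s c (SmallOps F Py Pd Pc (fun i => x (i + 1)) n)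

/-- `NoSatK F x n s c`: no SMALL operation saturates on any branch (every pre-rounding value of a
y-, d- or c-op lies in the hull of `F`). The large additions are unconstrained. -/
def NoSatK (F : Finset K) : (ℕ → K) → ℕ → K → K → Prop :=
  SmallOps F (InHull F) (InHull F) (InHull F)

omit [Field K] [IsStrictOrderedRing K] in
/-- `OnBoth` is monotone in the predicate. -/
theorem OnBoth.mono {F : Finset K} {e : K} {P Q : K → Prop} (hPQ : ∀ v, P v → Q v)
    (h : OnBoth F e P) : OnBoth F e Q :=
  ⟨hPQ _ h.1, hPQ _ h.2⟩

omit [IsStrictOrderedRing K] in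
/-- `StepAll` is monotone in the predicate. -/
theorem StepAll.mono {F : Finset K} {x s c : K} {P Q : K → K → Prop} (hPQ : ∀ t c', P t c' → Q t c')
    (h : StepAll F x s c P) : StepAll F x s c Q :=
  OnBoth.mono (fun _ hy => hy.mono fun t ht => ht.mono fun _ hd =>
    hd.mono fun c' hc => hPQ t c' hc) h

omit [IsStrictOrderedRing K] in
/-- `SmallOps` is monotone in the three predicates. -/
theorem SmallOps.mono {F : Finset K} {Py Pd Pc Qy Qd Qc : K → Prop} (hy : ∀ e, Py e → Qy e)
    (hd : ∀ e, Pd e → Qd e) (hc : ∀ e, Pc e → Qc e) (x : ℕ → K) (n : ℕ) (s c : K)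
    (h : SmallOps F Py Pd Pc x n s c) : SmallOps F Qy Qd Qc x n s c := by
  induction n generalizing x s c with
  | zero => trivial
  | succ n ih =>
      obtain ⟨⟨h1, h2⟩, h3⟩ := h
      exact ⟨⟨hy _ h1, h2.mono fun _ hy' => hy'.mono fun t ht =>
        ⟨hd _ ht.1, ht.2.mono fun _ => hc _⟩⟩, h3.mono fun t c' => ih _ t c'⟩

/-! ### Linearity, monotonicity, congruence on candidates -/

omit [IsStrictOrderedRing K] in
/-- A one-step expectation only depends on the integrand at the two candidates (`OnBoth` form). -/
theorem step_congr_onBoth {F : Finset K} {e : K} {f g : K → K} (h : OnBoth F e fun v => f v = g v) :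
    step F e f = step F e g :=
  step_congr F e h.1 h.2

omit [IsStrictOrderedRing K] in
/-- Expectation of an affine integrand: `E[a + b·SR(e)] = a + b·clamp(e)`. -/
theorem step_affine (F : Finset K) (e a b : K) :
    step F e (fun v => a + b * v) = a + b * clamp F e := by
  have hm := srMean_eq_self F (clamp F e)
  unfold srMean at hm
  unfold step pUp up dn
  linear_combination b * hm

omit [IsStrictOrderedRing K] in
/-- `kahanStep` only depends on the continuation at the reachable states. -/
theorem kahanStep_congr {F : Finset K} {x s c : K} {g₁ g₂ : K → K → K}
    (h : StepAll F x s c fun t c' => g₁ t c' = g₂ t c') :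
    kahanStep F x s c g₁ = kahanStep F x s c g₂ :=
  step_congr_onBoth (OnBoth.mono (fun _ hy => step_congr_onBoth (hy.mono fun _ ht =>
    step_congr_onBoth (ht.mono fun _ hd => step_congr_onBoth hd))) h)

omit [IsStrictOrderedRing K] in
/-- `kahanStep` is additive in the continuation. -/
theorem kahanStep_add (F : Finset K) (x s c : K) (g₁ g₂ : K → K → K) :
    kahanStep F x s c (fun t c' => g₁ t c' + g₂ t c')
      = kahanStep F x s c g₁ + kahanStep F x s c g₂ := by
  simp only [kahanStep, kahanInner, step_add]

omit [IsStrictOrderedRing K] in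
/-- `kahanStep` commutes with scalars. -/
theorem kahanStep_mul_left (F : Finset K) (x s c a : K) (g : K → K → K) :
    kahanStep F x s c (fun t c' => a * g t c') = a * kahanStep F x s c g := by
  simp only [kahanStep, kahanInner, step_mul_left]

omit [IsStrictOrderedRing K] in
/-- `kahanStep` of a constant (total mass one). -/
theorem kahanStep_const (F : Finset K) (x s c a : K) : kahanStep F x s c (fun _ _ => a) = a := by
  simp only [kahanStep, kahanInner, step_const]

/-- `kahanStep` is monotone in the continuation. -/
theorem kahanStep_mono (F : Finset K) (x s c : K) {g₁ g₂ : K → K → K}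
    (h : ∀ t c', g₁ t c' ≤ g₂ t c') : kahanStep F x s c g₁ ≤ kahanStep F x s c g₂ :=
  step_mono F _ fun _ => step_mono F _ fun t => step_mono F _ fun _ =>
    step_mono F _ fun c' => h t c'

omit [IsStrictOrderedRing K] in
/-- Linearity of `kahanExp`: additivity. -/
theorem kahanExp_add (F : Finset K) (x : ℕ → K) (n : ℕ) (g₁ g₂ : K → K → K) (s c : K) :
    kahanExp F x n (fun t c' => g₁ t c' + g₂ t c') s c
      = kahanExp F x n g₁ s c + kahanExp F x n g₂ s c := by
  induction n generalizing x s c with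
  | zero => rfl
  | succ n ih =>
      simp only [kahanExp]
      rw [← kahanStep_add]
      congr 1
      funext t c'
      exact ih _ t c'

omit [IsStrictOrderedRing K] in
/-- Linearity of `kahanExp`: scalars. -/
theorem kahanExp_mul_left (F : Finset K) (x : ℕ → K) (n : ℕ) (a : K) (g : K → K → K) (s c : K) :
    kahanExp F x n (fun t c' => a * g t c') s c = a * kahanExp F x n g s c := by
  induction n generalizing x s c with
  | zero => rfl
  | succ n ih =>
      simp only [kahanExp]
      rw [← kahanStep_mul_left]
      congr 1
      funext t c'
      exact ih _ t c'

omit [IsStrictOrderedRing K] in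
/-- Total mass one: the expectation of a constant is the constant. -/
theorem kahanExp_const (F : Finset K) (x : ℕ → K) (n : ℕ) (a s c : K) :
    kahanExp F x n (fun _ _ => a) s c = a := by
  induction n generalizing x s c with
  | zero => rfl
  | succ n ih =>
      simp only [kahanExp]
      rw [show kahanExp F (fun i => x (i + 1)) n (fun _ _ => a) = fun _ _ => a from
        funext fun t => funext fun c' => ih _ t c', kahanStep_const]

/-- Monotonicity of `kahanExp`. -/
theorem kahanExp_mono (F : Finset K) (x : ℕ → K) (n : ℕ) {g₁ g₂ : K → K → K}
    (h : ∀ t c', g₁ t c' ≤ g₂ t c') (s c : K) : kahanExp F x n g₁ s c ≤ kahanExp F x n g₂ s c := by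
  induction n generalizing x s c with
  | zero => exact h s c
  | succ n ih => simp only [kahanExp]; exact kahanStep_mono F _ _ _ fun t c' => ih _ t c'

/-! ### One step: the error of the large addition cancels -/

omit [IsStrictOrderedRing K] in
/-- Inner mean: `E[t − c' + B ∣ s, y, t] = s + y + B` — the error of `t` (saturation defect
included) is re-injected exactly by the compensation. -/
theorem kahanInner_sub {F : Finset K} {s y t : K} (B : K) (hd : InHull F (t - s))
    (hc : OnBoth F (t - s) fun d => InHull F (d - y)) :
    kahanInner F s y t (fun t c' => t - c' + B) = s + y + B := by
  have h1 : ∀ d, InHull F (d - y) →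
      step F (d - y) (fun c' => t - c' + B) = (t + B + y) + (-1) * d := by
    intro d hdd
    rw [show (fun c' => t - c' + B) = fun c' => (t + B) + (-1) * c' from funext fun _ => by ring,
      step_affine, clamp_eq_self hdd]
    ring
  calc kahanInner F s y t (fun t c' => t - c' + B)
      = step F (t - s) (fun d => (t + B + y) + (-1) * d) := step_congr_onBoth (hc.mono h1)
    _ = s + y + B := by rw [step_affine, clamp_eq_self hd]; ring

/-- Inner second moment: `E[(t − c' + B)² ∣ s, y, t] = innerVar + (s + y + B)²`. -/
theorem kahanInner_sq {F : Finset K} {s y t : K} (B : K) (hd : InHull F (t - s))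
    (hc : OnBoth F (t - s) fun d => InHull F (d - y)) :
    kahanInner F s y t (fun t c' => (t - c' + B) ^ 2) = innerVar F s y t + (s + y + B) ^ 2 := by
  have h1 : ∀ d, InHull F (d - y) → step F (d - y) (fun c' => (t - c' + B) ^ 2)
      = srVar F (clamp F (d - y)) + (d + -(y + t + B)) ^ 2 := by
    intro d hdd
    rw [show (fun c' => (t - c' + B) ^ 2) = fun c' => (c' + -(t + B)) ^ 2 from
      funext fun _ => by ring, step_sq_add, clamp_eq_self hdd]
    ring
  calc kahanInner F s y t (fun t c' => (t - c' + B) ^ 2)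
      = step F (t - s) (fun d => srVar F (clamp F (d - y)) + (d + -(y + t + B)) ^ 2) :=
        step_congr_onBoth (hc.mono h1)
    _ = (step F (t - s) fun d => srVar F (clamp F (d - y)))
          + step F (t - s) (fun d => (d + -(y + t + B)) ^ 2) := step_add F _ _ _
    _ = innerVar F s y t + (s + y + B) ^ 2 := by
          rw [innerVar, step_sq_add, clamp_eq_self hd]; ring

omit [IsStrictOrderedRing K] in
/-- **One compensated step, mean**: `E[t − c' + B] = s − c + x + B` as soon as the three small
operations stay in the hull (the large addition is free). -/
theorem kahanStep_sub {F : Finset K} {x s c : K} (B : K)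
    (h : StepSmall F (InHull F) (InHull F) (InHull F) x s c) :
    kahanStep F x s c (fun t c' => t - c' + B) = s - c + x + B := by
  obtain ⟨hy, hrest⟩ := h
  have h2 : ∀ y, (OnBoth F (s + y) fun t => InHull F (t - s) ∧ OnBoth F (t - s) fun d =>
      InHull F (d - y)) → step F (s + y) (fun t => kahanInner F s y t fun t c' => t - c' + B)
        = (s + B) + 1 * y := by
    intro y hy'
    calc step F (s + y) (fun t => kahanInner F s y t fun t c' => t - c' + B)
        = step F (s + y) (fun _ => s + y + B) :=
          step_congr_onBoth (hy'.mono fun t ht => kahanInner_sub B ht.1 ht.2)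
      _ = (s + B) + 1 * y := by rw [step_const]; ring
  calc kahanStep F x s c (fun t c' => t - c' + B)
      = step F (x - c) (fun y => (s + B) + 1 * y) := step_congr_onBoth (hrest.mono h2)
    _ = s - c + x + B := by rw [step_affine, clamp_eq_self hy]; ring

/-- **One compensated step, second moment**: `E[(t − c' + B)²] = localVar + (s − c + x + B)²`. -/
theorem kahanStep_sq {F : Finset K} {x s c : K} (B : K)
    (h : StepSmall F (InHull F) (InHull F) (InHull F) x s c) :
    kahanStep F x s c (fun t c' => (t - c' + B) ^ 2) = localVar F x s c + (s - c + x + B) ^ 2 := by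
  obtain ⟨hy, hrest⟩ := h
  have h2 : ∀ y, (OnBoth F (s + y) fun t => InHull F (t - s) ∧ OnBoth F (t - s) fun d =>
      InHull F (d - y)) → step F (s + y) (fun t => kahanInner F s y t fun t c' => (t - c' + B) ^ 2)
        = (step F (s + y) fun t => innerVar F s y t) + (y + (s + B)) ^ 2 := by
    intro y hy'
    calc step F (s + y) (fun t => kahanInner F s y t fun t c' => (t - c' + B) ^ 2)
        = step F (s + y) (fun t => innerVar F s y t + (s + y + B) ^ 2) :=
          step_congr_onBoth (hy'.mono fun t ht => kahanInner_sq B ht.1 ht.2)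
      _ = (step F (s + y) fun t => innerVar F s y t) + step F (s + y) (fun _ => (s + y + B) ^ 2) :=
          step_add F _ _ _
      _ = (step F (s + y) fun t => innerVar F s y t) + (y + (s + B)) ^ 2 := by rw [step_const]; ring
  calc kahanStep F x s c (fun t c' => (t - c' + B) ^ 2)
      = step F (x - c) (fun y => (step F (s + y) fun t => innerVar F s y t) + (y + (s + B)) ^ 2) :=
        step_congr_onBoth (hrest.mono h2)
    _ = (step F (x - c) fun y => step F (s + y) fun t => innerVar F s y t)
          + step F (x - c) (fun y => (y + (s + B)) ^ 2) := step_add F _ _ _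
    _ = localVar F x s c + (s - c + x + B) ^ 2 := by
          rw [localVar, step_sq_add, clamp_eq_self hy]; ring

/-! ### The corrected sum: exact mean and exact variance -/

omit [IsStrictOrderedRing K] in
/-- **Unbiasedness of compensated summation under SR (every finite format).** If no small operation
saturates on any branch, `E[sₙ − cₙ] = s − c + ∑_{k<n} xₖ` — the large additions may saturate. -/
theorem kahanExp_sub_of_noSatK (F : Finset K) (x : ℕ → K) (n : ℕ) (s c : K) (h : NoSatK F x n s c) :
    kahanExp F x n (fun s c => s - c) s c = s - c + ∑ i ∈ range n, x i := by
  induction n generalizing x s c with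
  | zero => simp [kahanExp]
  | succ n ih =>
      obtain ⟨hs, hall⟩ := h
      simp only [kahanExp]
      rw [sum_range_succ' x n]
      calc kahanStep F (x 0) s c (kahanExp F (fun i => x (i + 1)) n fun s c => s - c)
          = kahanStep F (x 0) s c (fun t c' => t - c' + ∑ i ∈ range n, x (i + 1)) :=
            kahanStep_congr (hall.mono fun t c' ht => ih _ t c' ht)
        _ = s - c + (∑ i ∈ range n, x (i + 1) + x 0) := by rw [kahanStep_sub _ hs]; ring

/-- **Exact variance identity for compensated summation under SR.** If no small operation saturates
on any branch then, for every centre `a`, `E[(sₙ − cₙ − a)²] = kahanVar + (s − c + ∑ xₖ − a)²`: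
the variance is the expected sum of the `3n` small-operation conditional variances. -/
theorem kahanExp_sq_sub (F : Finset K) (x : ℕ → K) (n : ℕ) (s c : K) (h : NoSatK F x n s c)
    (a : K) : kahanExp F x n (fun s c => (s - c - a) ^ 2) s c
      = kahanVar F x n s c + (s - c + ∑ i ∈ range n, x i - a) ^ 2 := by
  induction n generalizing x s c a with
  | zero => simp [kahanExp, kahanVar]
  | succ n ih =>
      obtain ⟨hs, hall⟩ := h
      simp only [kahanExp, kahanVar]
      rw [sum_range_succ' x n]
      set S := ∑ i ∈ range n, x (i + 1)
      calc kahanStep F (x 0) s c (kahanExp F (fun i => x (i + 1)) n fun s c => (s - c - a) ^ 2)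
          = kahanStep F (x 0) s c (fun t c' =>
              kahanVar F (fun i => x (i + 1)) n t c' + (t - c' + (S - a)) ^ 2) :=
            kahanStep_congr (hall.mono fun t c' ht => by rw [ih _ t c' ht a]; ring)
        _ = kahanStep F (x 0) s c (kahanVar F (fun i => x (i + 1)) n)
              + kahanStep F (x 0) s c (fun t c' => (t - c' + (S - a)) ^ 2) :=
            kahanStep_add F _ _ _ _ _
        _ = localVar F (x 0) s c + kahanStep F (x 0) s c (kahanVar F (fun i => x (i + 1)) n)
              + (s - c + (S + x 0) - a) ^ 2 := by rw [kahanStep_sq (S - a) hs]; ring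

/-- The variance about the exact corrected value: `Var[sₙ − cₙ] = kahanVar`. -/
theorem kahanExp_sq_sub_sum (F : Finset K) (x : ℕ → K) (n : ℕ) (s c : K) (h : NoSatK F x n s c) :
    kahanExp F x n (fun s' c' => (s' - c' - (s - c + ∑ i ∈ range n, x i)) ^ 2) s c
      = kahanVar F x n s c := by
  rw [kahanExp_sq_sub F x n s c h, sub_self, zero_pow two_ne_zero, add_zero]

end Summit.Ventures.CertifiedArithmetic.LowPrec.SR
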